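import Mathlib

/-!
# Sketch — crux-ideate stmt-KontsevichZagierPeriods-10665 (`IsogenyCertificates.XMapPeriodTransfer`), ideator 1

First lemmas of the two idea cards, stated over existing declarations (Mathlib only), so that
they elaborate independently of the farm's build of the route module.

* Card `duplication-saturation`: `dup_isDatum` (x∘[2] is an x-rational isogeny datum of the crux's
  typed shape, multiplier `c = 2`), `dup_sub_root_eq_sq` (2-descent square identity) and
  `root_le_dupX` (duplication lands on the unbounded component).
* Card `regular-fibres-clopen`: `regular_fibre` (every real point of the correspondence over
  `{P' > 0}` is a regular point of `{P > 0} ∖ Z(g·W)`) and the engine statement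
  `image_sheet_eq_component` (sheets cover whole components).
-/

open Polynomial Set

namespace Summit.KontsevichZagierPeriods.KontsevichZagierPeriods.Cruxes.XMapPeriodTransfer.Ideator1

/-! ## Card `duplication-saturation` -/

/-- Numerator of the x-map of multiplication by `2` on `y² = X³ + A X + B`. -/
noncomputable def dupNum (A B : ℚ) : ℚ[X] :=
  X ^ 4 - 2 * C A * X ^ 2 - 8 * C B * X + C A ^ 2

/-- Denominator `4·(X³ + A X + B)` of the x-map of multiplication by `2`. -/
noncomputable def dupDen (A B : ℚ) : ℚ[X] :=
  4 * (X ^ 3 + C A * X + C B)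

/-- **First lemma (card 1a).** Duplication is an x-rational isogeny datum of the typed shape of
`XMapPeriodTransfer`, from `(A, B)` to `(A, B)`, with multiplier `c = 2`:
`C (2²) · g₂ · (f₂³ + A f₂ g₂² + B g₂³) = (X³ + A X + B) · (f₂' g₂ − f₂ g₂')²`. -/
theorem dup_isDatum (A B : ℚ) :
    C ((2 : ℚ) ^ 2) * dupDen A B *
        (dupNum A B ^ 3 + C A * dupNum A B * dupDen A B ^ 2 + C B * dupDen A B ^ 3) =
      (X ^ 3 + C A * X + C B) *
        (derivative (dupNum A B) * dupDen A B - dupNum A B * derivative (dupDen A B)) ^ 2 := by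
  have hN : derivative (dupNum A B) = 4 * X ^ 3 - 4 * C A * X - 8 * C B := by
    simp only [dupNum, derivative_sub, derivative_add, derivative_mul, derivative_X_pow,
      derivative_X, derivative_C, derivative_ofNat, derivative_pow, Nat.cast_ofNat, map_ofNat,
      map_pow]
    ring
  have hD : derivative (dupDen A B) = 4 * (3 * X ^ 2 + C A) := by
    simp only [dupDen, derivative_add, derivative_mul, derivative_X_pow,
      derivative_X, derivative_C, derivative_ofNat, derivative_pow, Nat.cast_ofNat, map_ofNat,
      map_pow]
    ring
  rw [hN, hD]
  simp only [dupNum, dupDen, map_pow, map_ofNat]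
  ring

/-- **First lemma (card 1b), the 2-descent square identity.** If `e` is a root of
`P = X³ + A X + B` then `f₂ − 4 e P = (X² − 2 e X − A − 2 e²)²` (as real functions). -/
theorem dup_sub_root_eq_sq (A B e x : ℝ) (he : e ^ 3 + A * e + B = 0) :
    (x ^ 4 - 2 * A * x ^ 2 - 8 * B * x + A ^ 2) - 4 * e * (x ^ 3 + A * x + B) =
      (x ^ 2 - 2 * e * x - A - 2 * e ^ 2) ^ 2 := by
  linear_combination (-8 * x - 4 * e) * he

/-- **First lemma (card 1c), duplication lands on the unbounded component.** On `{P > 0}` the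
x-coordinate of `2Q` is `≥` every real root of `P`; in particular `x∘[2]` maps `{P > 0}` into the
closure of the unbounded component `(e_max, ∞)` of `{P > 0}`. -/
theorem root_le_dupX (A B e x : ℝ) (he : e ^ 3 + A * e + B = 0) (hx : 0 < x ^ 3 + A * x + B) :
    e ≤ (x ^ 4 - 2 * A * x ^ 2 - 8 * B * x + A ^ 2) / (4 * (x ^ 3 + A * x + B)) := by
  rw [le_div_iff₀ (by positivity)]
  have h := dup_sub_root_eq_sq A B e x he
  nlinarith [sq_nonneg (x ^ 2 - 2 * e * x - A - 2 * e ^ 2)]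

/-! ## Card `regular-fibres-clopen` -/

/-- **First lemma (card 2a), regular fibres.** For a coprime datum `(f, g, c)` towards
`P' = X³ + A' X + B'` (any `P` on the source side), every real solution `x` of `f(x) = X₀·g(x)`
over a point `X₀` with `P'(X₀) > 0` is a regular point: `g(x) ≠ 0`, `W(x) ≠ 0`, `P(x) > 0`. -/
theorem regular_fibre {A' B' c : ℝ} {P f g : ℝ[X]} (hc : c ≠ 0) (hfg : IsCoprime f g)
    (hid : C (c ^ 2) * g * (f ^ 3 + C A' * f * g ^ 2 + C B' * g ^ 3) =
      P * (derivative f * g - f * derivative g) ^ 2)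
    {X₀ x : ℝ} (hX₀ : 0 < X₀ ^ 3 + A' * X₀ + B') (hx : f.eval x = X₀ * g.eval x) :
    g.eval x ≠ 0 ∧ (derivative f * g - f * derivative g).eval x ≠ 0 ∧ 0 < P.eval x := by
  -- `g(x) ≠ 0`: otherwise `x` is a common root of the coprime pair `(f, g)`
  have hg : g.eval x ≠ 0 := by
    intro hg0
    have hf0 : f.eval x = 0 := by rw [hx, hg0, mul_zero]
    obtain ⟨a, b, hab⟩ := hfg
    have := congrArg (Polynomial.eval x) hab
    simp [eval_add, eval_mul, hf0, hg0] at this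
  -- evaluate the datum identity at `x` (keeping `W(x)` opaque)
  have key : c ^ 2 * (g.eval x) ^ 4 * (X₀ ^ 3 + A' * X₀ + B') =
      P.eval x * ((derivative f * g - f * derivative g).eval x) ^ 2 := by
    have := congrArg (Polynomial.eval x) hid
    simp only [eval_mul, eval_add, eval_pow, eval_C] at this
    rw [hx] at this
    linear_combination this
  have hpos : 0 < P.eval x * ((derivative f * g - f * derivative g).eval x) ^ 2 := by
    rw [← key]; positivity
  have hW : (derivative f * g - f * derivative g).eval x ≠ 0 := by
    intro hW
    rw [hW] at hpos
    simp at hpos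
  refine ⟨hg, hW, ?_⟩
  by_contra hP
  rw [not_lt] at hP
  have : P.eval x * ((derivative f * g - f * derivative g).eval x) ^ 2 ≤ 0 :=
    mul_nonpos_of_nonpos_of_nonneg hP (sq_nonneg _)
  linarith

/-- **Engine statement (card 2b), sheets cover whole components.** For a coprime datum from
`P = X³ + A X + B` to `P' = X³ + A' X + B'`, every connected component ("sheet") of
`S = {P > 0} ∖ Z(g·W)` is mapped by `R = f/g` onto a whole connected component of `{P' > 0}`.
(Proof plan: `R(sheet)` is connected, open in its component by strict monotonicity, and closed in
it by `regular_fibre` + compactness; a sequence escaping to `+∞` is excluded because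
`deg (P·W²) = 3 + 2 deg W` is odd, so `P·R'² → 0` or `∞` at `+∞`, never to `c² P'(X*) > 0`.) -/
theorem image_sheet_eq_component {A B A' B' c : ℝ} {f g : ℝ[X]} (hc : c ≠ 0) (hfg : IsCoprime f g)
    (hW : derivative f * g - f * derivative g ≠ 0)
    (hid : C (c ^ 2) * g * (f ^ 3 + C A' * f * g ^ 2 + C B' * g ^ 3) =
      (X ^ 3 + C A * X + C B) * (derivative f * g - f * derivative g) ^ 2)
    {x₀ : ℝ} (hx₀ : x₀ ∈ {x : ℝ | 0 < x ^ 3 + A * x + B ∧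
      (g * (derivative f * g - f * derivative g)).eval x ≠ 0}) :
    (fun x => f.eval x / g.eval x) ''
        connectedComponentIn {x : ℝ | 0 < x ^ 3 + A * x + B ∧
          (g * (derivative f * g - f * derivative g)).eval x ≠ 0} x₀ =
      connectedComponentIn {X : ℝ | 0 < X ^ 3 + A' * X + B'} (f.eval x₀ / g.eval x₀) := by
  sorry

/-- **Card 2, stub E2 (parity at infinity).** For `P = X³ + A X + B` and non-zero `W, g`, the
rational function `P·W²/g⁴` (which equals `c²·P′∘R` wherever `g ≠ 0`) tends to `0` or to `∞` in
absolute value at `+∞` — never to a finite non-zero limit — because `deg (P·W²) = 3 + 2·deg W` is odd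
while `deg g⁴ = 4·deg g` is even. This is the only asymptotic input of the clopen argument. -/
theorem parity_at_infinity (A B : ℝ) {W g : ℝ[X]} (hW : W ≠ 0) (hg : g ≠ 0) :
    Filter.Tendsto (fun x => ((X ^ 3 + C A * X + C B) * W ^ 2 : ℝ[X]).eval x / (g ^ 4 : ℝ[X]).eval x)
        Filter.atTop (nhds 0) ∨
      Filter.Tendsto (fun x => |((X ^ 3 + C A * X + C B) * W ^ 2 : ℝ[X]).eval x / (g ^ 4 : ℝ[X]).eval x|)
        Filter.atTop Filter.atTop := by
  set P : ℝ[X] := X ^ 3 + C A * X + C B with hPdef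
  have hP : P.natDegree = 3 := by rw [hPdef]; compute_degree!
  have hP0 : P ≠ 0 := by intro h; rw [h] at hP; simp at hP
  have hW2 : W ^ 2 ≠ 0 := pow_ne_zero 2 hW
  have hN0 : P * W ^ 2 ≠ 0 := mul_ne_zero hP0 hW2
  have hD0 : g ^ 4 ≠ 0 := pow_ne_zero 4 hg
  have hN : (P * W ^ 2).natDegree = 3 + 2 * W.natDegree := by
    rw [natDegree_mul hP0 hW2, natDegree_pow, hP]
  have hD : (g ^ 4).natDegree = 4 * g.natDegree := by rw [natDegree_pow]
  have hne : (P * W ^ 2).natDegree ≠ (g ^ 4).natDegree := by rw [hN, hD]; omega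
  rcases lt_or_gt_of_ne hne with h | h
  · left
    exact Polynomial.div_tendsto_atTop_zero_of_degree_lt _ _ (degree_lt_degree h)
  · right
    exact Polynomial.abs_div_tendsto_atTop_atTop_of_degree_gt _ _ (degree_lt_degree h) hD0

end Summit.KontsevichZagierPeriods.KontsevichZagierPeriods.Cruxes.XMapPeriodTransfer.Ideator1
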